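import Mathlib
import Literature.Analysis.Matrix.HadamardInequality

/-!
# The confluent Vandermonde determinant and its Hadamard bound (venture `DiscreteObjects`, target L)

Cell `pub-namedobj`, seat `pub-namedobj-mahler-g27`. Framing: lottery ticket; floor = certified bounds/negative ranges.

[cite: MckeeSmyth2021, Lemma 3.12] (Méray 1899): the **confluent Vandermonde determinant**.  For nodes
`v : ι → R` indexed by a finite linear order, let column `c` carry the ORDER `r c = #{c' < c | v c' = v c}` (the
number of earlier columns with the same node) and let row `i` carry the exponent `m = #{i' < i}`; the matrix
`W_{i,c} = C(m, r_c) · v_c^{m - r_c}` (column `c` = the `r_c`-th Hasse derivative of the Vandermonde column of `v_c`)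
has `det W = ∏_c ∏_{c' < c, v_{c'} ≠ v_c} (v_c - v_{c'})` (`det_confluentVandermonde`), i.e. `∏_{a<b} (z_b - z_a)^{m_a m_b}`
over the distinct nodes `z` with multiplicities `m`.  KERNEL PROOF by the Newton basis `P_c = ∏_{c'<c} (X - v_{c'})`
(unitriangular change of basis under which `(P ↦ Taylor coefficients)` becomes upper triangular with diagonal
`∏_{c'<c, v_{c'} ≠ v_c} (v_c - v_{c'})`) — a standard argument replacing the printed limiting process.
Over `ℂ`: `‖det W‖² = ∏_c ∏_{c' : v_{c'} ≠ v_c} ‖v_c - v_{c'}‖` (`norm_det_confluentVandermonde_sq`) and, by Hadamard's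
inequality (`Literature.Analysis.Matrix.norm_det_sq_le_of_entry_le`), [cite: MckeeSmyth2021, (3.6)–(3.7)]
`‖det W‖² ≤ ∏_c N^{2 r_c + 1} · max(1, ‖v_c‖)^{2(N-1)}`, `N = #ι` (`norm_det_confluentVandermonde_sq_le`).
Brick for the Cantor–Straus proof of Dobrowolski's theorem [cite: MckeeSmyth2021, Theorem 3.1].  REPLICATION, no new
mathematics.
-/

namespace Summit.Ventures.DiscreteObjects.Mahler

open Polynomial Finset Matrix

section General

variable {ι : Type*} [LinearOrder ι] [Fintype ι] {R : Type*} [CommRing R]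

/-- The row exponent of an index: the number of smaller indices (so the exponents `0, …, N-1` in increasing order). -/
def rowExp (i : ι) : ℕ := (univ.filter (· < i)).card

/-- `rowExp` is strictly increasing. -/
theorem rowExp_strictMono : StrictMono (rowExp : ι → ℕ) := by
  intro a b hab
  apply Finset.card_lt_card
  refine ⟨fun x hx => ?_, fun h => ?_⟩
  · simp only [mem_filter, mem_univ, true_and] at hx ⊢
    exact lt_trans hx hab
  · have ha : a ∈ univ.filter (· < b) := by simp [hab]
    have := h ha
    simp at this

/-- Every row exponent is `< N = #ι`. -/
theorem rowExp_lt_card (i : ι) : rowExp i < Fintype.card ι := by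
  unfold rowExp
  calc (univ.filter (· < i)).card < (univ : Finset ι).card := by
        apply Finset.card_lt_card
        refine ⟨Finset.filter_subset _ _, fun h => ?_⟩
        have := h (mem_univ i)
        simp at this
    _ = Fintype.card ι := Finset.card_univ

/-- `rowExp` is a bijection onto `Fin N`. -/
theorem rowExp_bijective :
    Function.Bijective (fun i : ι => (⟨rowExp i, rowExp_lt_card i⟩ : Fin (Fintype.card ι))) := by
  rw [Fintype.bijective_iff_injective_and_card]
  refine ⟨fun a b h => rowExp_strictMono.injective ?_, by simp⟩
  have := congrArg Fin.val h
  simpa using this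

/-- A sum over `ι` of a function of the row exponent is the sum over `range N`. -/
theorem sum_rowExp_eq_sum_range {M : Type*} [AddCommMonoid M] (g : ℕ → M) :
    ∑ i : ι, g (rowExp i) = ∑ m ∈ range (Fintype.card ι), g m := by
  rw [← Fin.sum_univ_eq_sum_range]
  exact Fintype.sum_bijective _ rowExp_bijective (fun i => g (rowExp i)) (fun m => g m) (fun _ => rfl)

/-- **The confluent Vandermonde matrix** of nodes `v` with column orders `r`:
`W_{i,c} = C(m, r_c) · v_c^{m - r_c}` with `m = rowExp i`. -/
def confluentVandermonde (v : ι → R) (r : ι → ℕ) : Matrix ι ι R :=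
  Matrix.of fun i c => ((rowExp i).choose (r c) : R) * v c ^ (rowExp i - r c)

/-- Entries of the confluent Vandermonde matrix. -/
theorem confluentVandermonde_apply (v : ι → R) (r : ι → ℕ) (i c : ι) :
    confluentVandermonde v r i c = ((rowExp i).choose (r c) : R) * v c ^ (rowExp i - r c) := rfl

/-- The Newton basis polynomial of column `c`: `P_c = ∏_{c' < c} (X - v_{c'})`. -/
noncomputable def newtonPoly (v : ι → R) (c : ι) : R[X] := ∏ c' ∈ univ.filter (· < c), (X - C (v c'))

/-- The Newton polynomials are monic. -/
theorem newtonPoly_monic (v : ι → R) (c : ι) : (newtonPoly v c).Monic :=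
  monic_prod_of_monic _ _ fun _ _ => monic_X_sub_C _

/-- `deg P_c = rowExp c`. -/
theorem natDegree_newtonPoly [Nontrivial R] (v : ι → R) (c : ι) : (newtonPoly v c).natDegree = rowExp c := by
  rw [newtonPoly, natDegree_prod_of_monic _ _ (fun _ _ => monic_X_sub_C _)]
  simp [rowExp]

/-- Taylor coefficients as a sum over the row exponents: for `deg F < N`,
`(taylor x F)_k = ∑_i F_m · C(m,k) x^{m-k}` (`m = rowExp i`). -/
theorem taylor_coeff_eq_sum_rowExp (F : R[X]) (hF : F.natDegree < Fintype.card ι) (x : R) (k : ℕ) :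
    (taylor x F).coeff k = ∑ i : ι, F.coeff (rowExp i) * (((rowExp i).choose k : R) * x ^ (rowExp i - k)) := by
  rw [taylor_coeff, hasseDeriv_apply, eval_sum]
  simp only [eval_monomial]
  rw [sum_over_range' F (fun n => by simp) _ hF,
    sum_rowExp_eq_sum_range (fun m => F.coeff m * (((m.choose k : ℕ) : R) * x ^ (m - k)))]
  exact Finset.sum_congr rfl fun n _ => by ring

/-- The change-of-basis matrix `B_{c,i} = (P_c)_{rowExp i}` (monomial coordinates of the Newton basis). -/
noncomputable def newtonMatrix (v : ι → R) : Matrix ι ι R := Matrix.of fun c i => (newtonPoly v c).coeff (rowExp i)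

/-- `B` is lower unitriangular, so `det B = 1`. -/
theorem det_newtonMatrix [Nontrivial R] (v : ι → R) : (newtonMatrix v).det = 1 := by
  rw [det_of_lowerTriangular (newtonMatrix v) ?_]
  · refine Finset.prod_eq_one fun c _ => ?_
    show (newtonPoly v c).coeff (rowExp c) = 1
    rw [← natDegree_newtonPoly v c]
    exact (newtonPoly_monic v c).leadingCoeff
  · intro c i hci
    have hlt : c < i := hci
    show (newtonPoly v c).coeff (rowExp i) = 0
    apply coeff_eq_zero_of_natDegree_lt
    rw [natDegree_newtonPoly]
    exact rowExp_strictMono hlt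

/-- The entries of `B · W` are Taylor coefficients of the Newton polynomials:
`(B W)_{c,c₂} = (taylor v_{c₂} P_c)_{r c₂}`. -/
theorem newtonMatrix_mul_apply [Nontrivial R] (v : ι → R) (r : ι → ℕ) (c c₂ : ι) :
    (newtonMatrix v * confluentVandermonde v r) c c₂ = (taylor (v c₂) (newtonPoly v c)).coeff (r c₂) := by
  rw [Matrix.mul_apply, taylor_coeff_eq_sum_rowExp (newtonPoly v c)
    (by rw [natDegree_newtonPoly]; exact rowExp_lt_card c)]
  rfl

/-- `taylor x ((X - x)^n · Q) = X^n · taylor x Q`. -/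
theorem taylor_X_sub_C_pow_mul (x : R) (n : ℕ) (Q : R[X]) :
    taylor x ((X - C x) ^ n * Q) = X ^ n * taylor x Q := by
  rw [taylor_mul, taylor_pow, map_sub, taylor_X, taylor_C, add_sub_cancel_right]

variable [DecidableEq R]

/-- The order of column `c`: the number of EARLIER columns with the same node. -/
def colOrder (v : ι → R) (c : ι) : ℕ := (univ.filter (fun c' => c' < c ∧ v c' = v c)).card

/-- Splitting the Newton polynomial at a value `x`:
`P_c = (X - x)^{#\{c'<c, v_{c'} = x\}} · ∏_{c'<c, v_{c'} ≠ x} (X - v_{c'})`. -/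
theorem newtonPoly_eq_pow_mul (v : ι → R) (c : ι) (x : R) :
    newtonPoly v c = (X - C x) ^ (univ.filter (fun c' => c' < c ∧ v c' = x)).card *
      ∏ c' ∈ univ.filter (fun c' => c' < c ∧ v c' ≠ x), (X - C (v c')) := by
  rw [newtonPoly, ← Finset.prod_filter_mul_prod_filter_not (univ.filter (· < c)) (fun c' => v c' = x),
    Finset.filter_filter, Finset.filter_filter]
  congr 1
  rw [← Finset.prod_const]
  exact Finset.prod_congr rfl fun c' hc' => by
    simp only [mem_filter, mem_univ, true_and] at hc'
    rw [hc'.2]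

/-- Below the diagonal `B · W` vanishes: for `c₂ < c`, `(X - v_{c₂})^{r c₂ + 1} ∣ P_c`. -/
theorem newtonMatrix_mul_apply_of_lt [Nontrivial R] (v : ι → R) {c c₂ : ι} (h : c₂ < c) :
    (newtonMatrix v * confluentVandermonde v (colOrder v)) c c₂ = 0 := by
  rw [newtonMatrix_mul_apply, newtonPoly_eq_pow_mul v c (v c₂), taylor_X_sub_C_pow_mul, coeff_X_pow_mul']
  rw [if_neg]
  rw [not_le, colOrder]
  apply Finset.card_lt_card
  refine ⟨fun x hx => ?_, fun hsub => ?_⟩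
  · simp only [mem_filter, mem_univ, true_and] at hx ⊢
    exact ⟨lt_trans hx.1 h, hx.2⟩
  · have hmem : c₂ ∈ univ.filter (fun c' => c' < c ∧ v c' = v c₂) := by simp [h]
    have := hsub hmem
    simp at this

/-- The diagonal of `B · W`: `(taylor v_c P_c)_{r c} = ∏_{c'<c, v_{c'} ≠ v_c} (v_c - v_{c'})`. -/
theorem newtonMatrix_mul_apply_self [Nontrivial R] (v : ι → R) (c : ι) :
    (newtonMatrix v * confluentVandermonde v (colOrder v)) c c =
      ∏ c' ∈ univ.filter (fun c' => c' < c ∧ v c' ≠ v c), (v c - v c') := by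
  rw [newtonMatrix_mul_apply, newtonPoly_eq_pow_mul v c (v c), taylor_X_sub_C_pow_mul]
  rw [show colOrder v c = (univ.filter (fun c' => c' < c ∧ v c' = v c)).card from rfl, coeff_X_pow_mul',
    if_pos le_rfl, Nat.sub_self, taylor_coeff_zero, eval_prod]
  exact Finset.prod_congr rfl fun c' _ => by rw [eval_sub, eval_X, eval_C]

/-- **The confluent Vandermonde determinant** [cite: MckeeSmyth2021, Lemma 3.12]:
`det W = ∏_c ∏_{c' < c, v_{c'} ≠ v_c} (v_c - v_{c'})` when every column `c` has order
`r c = #{c' < c | v_{c'} = v_c}`. -/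
theorem det_confluentVandermonde [Nontrivial R] (v : ι → R) :
    (confluentVandermonde v (colOrder v)).det =
      ∏ c, ∏ c' ∈ univ.filter (fun c' => c' < c ∧ v c' ≠ v c), (v c - v c') := by
  have hT : (newtonMatrix v * confluentVandermonde v (colOrder v)).det =
      ∏ c, ∏ c' ∈ univ.filter (fun c' => c' < c ∧ v c' ≠ v c), (v c - v c') := by
    rw [det_of_upperTriangular]
    · exact Finset.prod_congr rfl fun c _ => newtonMatrix_mul_apply_self v c
    · intro c c₂ h
      exact newtonMatrix_mul_apply_of_lt v h
  rw [det_mul, det_newtonMatrix, one_mul] at hT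
  exact hT

end General

/-! ### Over `ℂ`: the norm of the determinant and its Hadamard bound -/

section Complex

variable {ι : Type*} [LinearOrder ι] [Fintype ι]

/-- Symmetrising the triangular product: `(∏_c ∏_{c'<c, v'≠v} ‖v_c - v_{c'}‖)² = ∏_c ∏_{v_{c'} ≠ v_c} ‖v_c - v_{c'}‖`. -/
theorem prod_prod_filter_lt_sq (v : ι → ℂ) :
    (∏ c, ∏ c' ∈ univ.filter (fun c' => c' < c ∧ v c' ≠ v c), ‖v c - v c'‖) ^ 2 =
      ∏ c, ∏ c' ∈ univ.filter (fun c' => v c' ≠ v c), ‖v c - v c'‖ := by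
  classical
  -- the `>` half equals the `<` half after swapping the roles of `c, c'`
  have hswap : ∏ c, ∏ c' ∈ univ.filter (fun c' => c < c' ∧ v c' ≠ v c), ‖v c - v c'‖ =
      ∏ c, ∏ c' ∈ univ.filter (fun c' => c' < c ∧ v c' ≠ v c), ‖v c - v c'‖ := by
    rw [Finset.prod_comm' (t' := univ) (s' := fun c' => univ.filter (fun c => c < c' ∧ v c' ≠ v c))]
    · refine Finset.prod_congr rfl fun c' _ => Finset.prod_congr ?_ fun c _ => norm_sub_rev _ _
      ext c
      simp only [mem_filter, mem_univ, true_and]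
      exact ⟨fun h => ⟨h.1, fun e => h.2 e.symm⟩, fun h => ⟨h.1, fun e => h.2 e.symm⟩⟩
    · intro c c'
      simp
  have hsplit : ∀ c, ∏ c' ∈ univ.filter (fun c' => v c' ≠ v c), ‖v c - v c'‖ =
      (∏ c' ∈ univ.filter (fun c' => c' < c ∧ v c' ≠ v c), ‖v c - v c'‖) *
        ∏ c' ∈ univ.filter (fun c' => c < c' ∧ v c' ≠ v c), ‖v c - v c'‖ := by
    intro c
    rw [← Finset.prod_union]
    · congr 1
      ext c'
      simp only [mem_filter, mem_univ, true_and, mem_union]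
      constructor
      · intro h
        rcases lt_trichotomy c' c with hlt | heq | hgt
        · exact Or.inl ⟨hlt, h⟩
        · exact absurd (congrArg v heq) h
        · exact Or.inr ⟨hgt, h⟩
      · rintro (h | h) <;> exact h.2
    · rw [Finset.disjoint_filter]
      intro c' _ h1 h2
      exact lt_asymm h1.1 h2.1
  rw [sq]
  nth_rw 2 [← hswap]
  rw [← Finset.prod_mul_distrib]
  exact Finset.prod_congr rfl fun c _ => by rw [hsplit c]

/-- `‖det W‖² = ∏_c ∏_{c' : v_{c'} ≠ v_c} ‖v_c - v_{c'}‖` for the confluent Vandermonde matrix over `ℂ`. -/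
theorem norm_det_confluentVandermonde_sq (v : ι → ℂ) :
    ‖(confluentVandermonde v (colOrder v)).det‖ ^ 2 = ∏ c, ∏ c' ∈ univ.filter (fun c' => v c' ≠ v c), ‖v c - v c'‖ := by
  rw [det_confluentVandermonde, norm_prod, ← prod_prod_filter_lt_sq]
  congr 1
  exact Finset.prod_congr rfl fun c _ => norm_prod _ _

/-- Entry bound: `‖W_{i,c}‖ ≤ N^{r_c} · max(1,‖v_c‖)^{N-1}`. -/
theorem norm_confluentVandermonde_apply_le (v : ι → ℂ) (r : ι → ℕ) (i c : ι) :
    ‖confluentVandermonde v r i c‖ ≤ (Fintype.card ι : ℝ) ^ r c * (max 1 ‖v c‖) ^ (Fintype.card ι - 1) := by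
  rw [confluentVandermonde_apply, norm_mul, norm_pow, Complex.norm_natCast]
  have hN := rowExp_lt_card i
  refine mul_le_mul ?_ ?_ (by positivity) (by positivity)
  · calc ((rowExp i).choose (r c) : ℝ) ≤ ((rowExp i) ^ (r c) : ℕ) := by exact_mod_cast Nat.choose_le_pow _ _
      _ = (rowExp i : ℝ) ^ r c := by push_cast; rfl
      _ ≤ (Fintype.card ι : ℝ) ^ r c := pow_le_pow_left₀ (by positivity) (by exact_mod_cast hN.le) _
  · calc ‖v c‖ ^ (rowExp i - r c) ≤ (max 1 ‖v c‖) ^ (rowExp i - r c) :=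
          pow_le_pow_left₀ (norm_nonneg _) (le_max_right _ _) _
      _ ≤ (max 1 ‖v c‖) ^ (Fintype.card ι - 1) := pow_le_pow_right₀ (le_max_left _ _) (by omega)

/-- **Hadamard bound for the confluent Vandermonde determinant** [cite: MckeeSmyth2021, (3.6)–(3.7)]:
`‖det W‖² ≤ ∏_c N^{2 r_c + 1} · max(1,‖v_c‖)^{2(N-1)}`. -/
theorem norm_det_confluentVandermonde_sq_le (v : ι → ℂ) (r : ι → ℕ) :
    ‖(confluentVandermonde v r).det‖ ^ 2 ≤
      ∏ c, ((Fintype.card ι : ℝ) ^ (2 * r c + 1) * (max 1 ‖v c‖) ^ (2 * (Fintype.card ι - 1))) := by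
  rw [← det_transpose]
  have h := Literature.Analysis.Matrix.norm_det_sq_le_of_entry_le (confluentVandermonde v r).transpose
    (fun c => (Fintype.card ι : ℝ) ^ r c * (max 1 ‖v c‖) ^ (Fintype.card ι - 1))
    (fun c i => by rw [transpose_apply]; exact norm_confluentVandermonde_apply_le v r i c)
  refine h.trans (le_of_eq (Finset.prod_congr rfl fun c _ => ?_))
  rw [mul_pow, ← pow_mul, ← pow_mul, pow_succ, mul_comm (r c) 2, mul_comm (Fintype.card ι - 1) 2]
  ring

end Complex

end Summit.Ventures.DiscreteObjects.Mahler
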